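import Summits.BirchSwinnertonDyer.BirchSwinnertonDyer.Theorems.SignedLowerHalvesSmallImageLowerHalfBothSignsLambdaLowerThreeNsDoor
import Summits.BirchSwinnertonDyer.BirchSwinnertonDyer.Theses.SignedLowerHalves
import Literature.NumberTheory.EllipticCurves.Kobayashi2003.SignedSelmerCorankBoundProofs
import HarnessLib

/-!
# Route `SignedLowerHalves` (K3), child crux L `SmallImageLowerHalfBothSigns` (item stmt-BirchSwinnertonDyer-23599),
# line `birth_acns` v14, stub `stub_lambdaLowerThree_ns` (= retired item 23118 `SmallImageLambdaLowerAtThree`, VERBATIM):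
# the stub BY NAME ⟺ the Eisenstein λ-INEQUALITY `λ(L_3^ε) ≤ λ(ξ^ε)`; the corank squeeze; and ⟺ its EXCESS-ZERO
# RESIDUE off the two preprint loci (by-name readings; the route-independent λ-door is `…LambdaLowerThreeNsDoor.lean`)

Cell `bsd-ssimc`, width seat `bsd-line-slh-p3-w3` gen 0 (helper file `--supports stmt-BirchSwinnertonDyer-23599`;
CALIBRATION / SUPPORT ONLY: the stub is NOT closed, no stub of the line of record is touched). HONEST FRAMING: the
stub is conjecture-grade (no engine in print at non-square-free conductor and small image); every theorem is
CONDITIONAL on DISPLAYED binders — published named facts (`h12`, `h41`, `h3`), the tree's two unrefereed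
binders (`FouquetWan2021_thm51_via_kobayashi74_OPEN`, `BurungaleSkinnerTianWan2024_thm13_twist_OPEN`), or the
residue of the stub itself. THEOREMS ONLY; no definition, no named fact, no `sorry`; BSD / child L / the stub NOT proved.

## What is proved

* §1 `smallImageLambdaLowerAtThree_iff_lamLe` — modulo Kobayashi Thm. 1.2 / 4.1 (rational display) ONLY:
  `Theses.SignedLowerHalves.SmallImageLambdaLowerAtThree` (= the stub's text) ⟺ «at every `p = 3`, X7, ¬CM,
  `a_3 = 0`, ¬Surj pair, every sign `ε`, every cyclotomic frame, the newform `f`, every (idle) period ratio, every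
  Pollack pair and every dual datum `D`: `lam (L_3^ε) ≤ lam ξ` for every generator `ξ` of `char X^ε`»; primed
  version without the idle period binder granted `h3`. READING: `ϖ`, `h`, `m` are gone; the stub is the EISENSTEIN
  λ-INEQUALITY `λ_an^ε ≤ λ_alg^ε` (with `h41`, the λ-EQUALITY), the natural output of a λ-transfer / congruence engine
  (B. D. Kim 2009 Cor. 2.13 on the algebraic side) — `μ` plays no role in this stub.
* §2 (the CORANK SQUEEZE, image-free and `μ`-free): `corank_{ℤ_p} Sel_{p^∞}(E/ℚ) ≤ λ(ξ^ε)` (signed corank control,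
  tree theorem) and `≤ λ(L_p^ε)` (Kato rational); hence `λ(L_p^ε) ≤ corank` («no excess zeros») ⟹ the stub's
  conclusion at that sign (`lambdaShape_of_lam_le_selmerCorank`).
* §3 `smallImageLambdaLowerAtThree_of_loci_of_excessZeroResidue` / `excessZeroResidue_of_smallImageLambdaLowerAtThree`
  — the stub BY NAME ⟸ the two PRE binders ∧ `h12 h41` ∧ the EXCESS-ZERO RESIDUE «λ-inequality at the Pollack pairs
  with `corank Sel_{3^∞}(E/ℚ) < λ(L_3^ε)` of the pairs OFF both loci»; and conversely (granted `h3` to instantiate the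
  stub). No period fact, no parity, no `μ` in the forward direction; slh-p3 g12's parity stratum lies inside the squeeze.

References: [Kobayashi2003] Thm. 1.2, Thm. 4.1 (p. 8), Thm. 7.4 (p. 13), Conjecture (p. 2); [GreenbergVatsal2000] p. 4,
§3 Rem. 3.4; [BDKim2009] Cor. 2.13; [Mazur1978] Cor. 4.1; [FouquetWan2021] Thm. 5.1 (PRE);
[BurungaleSkinnerTianWan2024] Thm. 1.3 (PRE); [GreenbergLNM1716] §3 Lemma 3.1.
-/

set_option autoImplicit false
-- D-0017: single-problem summit, the namespace repeats the problem name by design.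
set_option linter.dupNamespace false

noncomputable section

open scoped Classical MatrixGroups ModularForm

open CongruenceSubgroup PowerSeries WeierstrassCurve Field Literature.NumberTheory.EllipticCurves
  Literature.NumberTheory.EllipticCurves.ModularForms
  Literature.NumberTheory.EllipticCurves.Rank1Residual
  Literature.NumberTheory.EllipticCurves.Kobayashi2003 ZpExtension
  Literature.NumberTheory.EllipticCurves.Rank1Residual.Typed
  Summit.BirchSwinnertonDyer.Rank1Residual.X1.MuLambda
  Summit.BirchSwinnertonDyer.Rank1Residual.Supersingular

namespace Summit.BirchSwinnertonDyer.BirchSwinnertonDyer.Theorems.SmallImageLambdaLowerThreeNs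

open SmallImageLambdaLowerThreeNsDoor

/-! ## §1. The stub BY NAME ⟺ the Eisenstein λ-inequality, modulo Kobayashi Thm. 1.2 / 4.1 (rational) -/

section ByName

/-- **`stub_lambdaLowerThree_ns` (= `Theses.SignedLowerHalves.SmallImageLambdaLowerAtThree`, retired item 23118,
VERBATIM) IS THE EISENSTEIN λ-INEQUALITY.** Granted BY NAME Kobayashi Thm. 1.2 (`h12`) and Thm. 4.1 (`h41`, only its
image-free rational display): the stub holds IFF at every `p = 3`, X7, non-CM, `a_3 = 0`, non-surjective pair, every
sign `ε`, every cyclotomic frame `(κ, γ)`, the newform `f` of level `N_E`, every period ratio `ϖ` (an IDLE binder on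
the right), every Pollack pair `(L⁺, L⁻)` and every dual datum `D` of `Sel^ε(E/ℚ_∞)`:
`lam (L_3^ε) ≤ lam ξ` for every generator `ξ` of `char X^ε` (`L_3^ε = kobayashiL ε L⁺ L⁻`). READING: the period
ratio, the cofactor `h` and the `p`-power `p^m` of the stub are eliminated; what is asked is `λ_an^ε ≤ λ_alg^ε`
(with `h41`, `λ_an^ε = λ_alg^ε`) — a statement a λ-transfer / congruence engine outputs (B. D. Kim 2009 Cor. 2.13 on
the algebraic side). CALIBRATION ONLY; the stub is OPEN. [cite: Kobayashi2003, Thm. 1.2, Thm. 4.1 (p. 8) and Conjecture (p. 2)]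
[cite: GreenbergVatsal2000, p. 4 (after Thm. (1.2))] [cite: BDKim2009, Cor. 2.13] -/
theorem smallImageLambdaLowerAtThree_iff_lamLe
    (h12 : Kobayashi2003.thm12_signedSelmerDual_finite_torsion)
    (h41 : Kobayashi2003.thm41_signedCharIdeal_divisibility) :
    Summit.BirchSwinnertonDyer.BirchSwinnertonDyer.Theses.SignedLowerHalves.SmallImageLambdaLowerAtThree ↔
    ∀ (W : WeierstrassCurve ℚ) [W.IsElliptic] [W.IsGloballyMinimal] (p : ℕ) [Fact p.Prime],
      p = 3 → ClassX7 W p → ¬ W.HasCM → W.frobeniusTrace p = 0 → ¬ Surj W p →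
      ∀ (ε : ℤˣ) (κ : ZpExtension ℚ p) (γ : absoluteGaloisGroup ℚ),
          κ.IsCyclotomic → κ.IsTopGenerator γ → IsCyclotomicVariable p γ →
        ∀ [NeZero (W.conductorNorm ℤ)] (f : CuspForm (Gamma0 (W.conductorNorm ℤ)) 2),
          IsNewformOf W f → ∀ (ϖ : ℚ), (ϖ : ℝ) * W.realPeriodRat = plusPeriod f →
        ∀ (Lplus Lminus : IwasawaAlgebra p), IsPollackPair f p Lplus Lminus →
        ∀ (D : SignedSelmerDualData W κ γ ε) (ξ : IwasawaAlgebra p), D.charIdeal = Ideal.span {ξ} →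
          lam (kobayashiL ε Lplus Lminus) ≤ lam ξ := by
  constructor
  · intro h W _ _ p _ hp3 hX hCM hap hs ε κ γ hκ hγ hγ' _ f hf ϖ hϖ Lplus Lminus hPP D ξ hξ
    have hϖ0 : ϖ ≠ 0 := by
      rintro rfl
      rw [Rat.cast_zero, zero_mul] at hϖ
      exact (IsNewform0.plusPeriod_pos_holds hf.1 hf.coeffField_eq_bot).ne' hϖ.symm
    have hp : p ≠ 2 := by rw [hp3]; decide
    have hKato := exists_C_pow_mul_mem_charIdeal h12 h41 hp hX.1.1 hap hf hκ hγ hγ'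
      (hPP.isSignedPAdicLFunction_kobayashiL ε) D
    exact (lambdaShape_iff_forall_lam_le D hϖ0 (IsPollackPair.kobayashiL_ne_zero p hPP ε) hKato).mp
      (h W p hp3 hX hCM hap hs ε κ γ hκ hγ hγ' f hf ϖ hϖ Lplus Lminus hPP D) ξ hξ
  · intro h W _ _ p _ hp3 hX hCM hap hs ε κ γ hκ hγ hγ' _ f hf ϖ hϖ Lplus Lminus hPP D
    have hϖ0 : ϖ ≠ 0 := by
      rintro rfl
      rw [Rat.cast_zero, zero_mul] at hϖ
      exact (IsNewform0.plusPeriod_pos_holds hf.1 hf.coeffField_eq_bot).ne' hϖ.symm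
    have hp : p ≠ 2 := by rw [hp3]; decide
    have hKato := exists_C_pow_mul_mem_charIdeal h12 h41 hp hX.1.1 hap hf hκ hγ hγ'
      (hPP.isSignedPAdicLFunction_kobayashiL ε) D
    exact (lambdaShape_iff_forall_lam_le D hϖ0 (IsPollackPair.kobayashiL_ne_zero p hPP ε) hKato).mpr
      (h W p hp3 hX hCM hap hs ε κ γ hκ hγ hγ' f hf ϖ hϖ Lplus Lminus hPP D)

/-- **The same with the idle period binder removed, granted the `p = 3` period comparison `h3`** (Mazur 1978 Cor. 4.1
via Greenberg–Vatsal Rem. 3.4: `Ω_E = u · Ω⁺_f`, `|u|_3 = 1`, which SUPPLIES a period ratio `ϖ = u⁻¹`): the stub IFF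
«`lam (L_3^ε) ≤ lam ξ` for every pair, sign, frame, newform, Pollack pair, datum and generator». CALIBRATION ONLY.
[cite: Kobayashi2003, Thm. 1.2, Thm. 4.1 (p. 8)] [cite: GreenbergVatsal2000, §3 Remark 3.4] [cite: Mazur1978, Cor. 4.1] -/
theorem smallImageLambdaLowerAtThree_iff_lamLe'
    (h12 : Kobayashi2003.thm12_signedSelmerDual_finite_torsion)
    (h41 : Kobayashi2003.thm41_signedCharIdeal_divisibility)
    (h3 : realPeriodRat_eq_unit_mul_plusPeriod_three) :
    Summit.BirchSwinnertonDyer.BirchSwinnertonDyer.Theses.SignedLowerHalves.SmallImageLambdaLowerAtThree ↔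
    ∀ (W : WeierstrassCurve ℚ) [W.IsElliptic] [W.IsGloballyMinimal] (p : ℕ) [Fact p.Prime],
      p = 3 → ClassX7 W p → ¬ W.HasCM → W.frobeniusTrace p = 0 → ¬ Surj W p →
      ∀ (ε : ℤˣ) (κ : ZpExtension ℚ p) (γ : absoluteGaloisGroup ℚ),
          κ.IsCyclotomic → κ.IsTopGenerator γ → IsCyclotomicVariable p γ →
        ∀ [NeZero (W.conductorNorm ℤ)] (f : CuspForm (Gamma0 (W.conductorNorm ℤ)) 2), IsNewformOf W f →
        ∀ (Lplus Lminus : IwasawaAlgebra p), IsPollackPair f p Lplus Lminus →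
        ∀ (D : SignedSelmerDualData W κ γ ε) (ξ : IwasawaAlgebra p), D.charIdeal = Ideal.span {ξ} →
          lam (kobayashiL ε Lplus Lminus) ≤ lam ξ := by
  rw [smallImageLambdaLowerAtThree_iff_lamLe h12 h41]
  constructor
  · intro h W _ _ p _ hp3 hX hCM hap hs ε κ γ hκ hγ hγ' _ f hf Lplus Lminus hPP D ξ hξ
    subst hp3
    -- a period ratio exists by `h3`
    obtain ⟨u, hu1, hu⟩ := h3 W hX.1.1 (ClassX7.irr W 3 (by decide) hX) f hf
    have hu0 : u ≠ 0 := by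
      rintro rfl
      simp at hu1
    have hϖ : ((u⁻¹ : ℚ) : ℝ) * W.realPeriodRat = plusPeriod f := by
      rw [hu]; push_cast; field_simp
    exact h W 3 rfl hX hCM hap hs ε κ γ hκ hγ hγ' f hf u⁻¹ hϖ Lplus Lminus hPP D ξ hξ
  · intro h W _ _ p _ hp3 hX hCM hap hs ε κ γ hκ hγ hγ' _ f hf ϖ _ Lplus Lminus hPP D ξ hξ
    exact h W p hp3 hX hCM hap hs ε κ γ hκ hγ hγ' f hf Lplus Lminus hPP D ξ hξ

end ByName

/-! ## §2. The corank squeeze (image-free, `μ`-free): `corank Sel_{3^∞}(E/ℚ) ≤ λ(ξ^ε) ≤ λ(L_3^ε)` -/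

section Corank

variable {p : ℕ} [Fact p.Prime] {W : WeierstrassCurve ℚ} [W.IsElliptic] [W.IsGloballyMinimal]
  {κ : ZpExtension ℚ p} {γ : absoluteGaloisGroup ℚ} {ε : ℤˣ}

/-- **`corank_{ℤ_p} Sel_{p^∞}(E/ℚ) ≤ λ(ξ^ε)` for every generator `ξ^ε` of `char X^ε`** (signed corank control, a tree
theorem: `T^{corank} ∣ ξ^ε`), granted Kobayashi Thm. 1.2 (`h12`: `X^ε` finitely generated torsion); odd good `p`,
`a_p = 0`, ANY image, ANY `μ`. [cite: Kobayashi2003, Thm. 1.2 (p. 2)] [cite: GreenbergLNM1716, §1 p. 65 and §3 Lemma 3.1] -/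
theorem selmerCorank_le_lam_charGen (h12 : Kobayashi2003.thm12_signedSelmerDual_finite_torsion) (hp : p ≠ 2)
    (hgood : W.HasGoodReductionAtPrime p) (hap : W.frobeniusTrace p = 0) (hκ : κ.IsCyclotomic)
    (hγ : κ.IsTopGenerator γ) (D : SignedSelmerDualData W κ γ ε) {ξ : IwasawaAlgebra p}
    (hξ : D.charIdeal = Ideal.span {ξ}) : W.selmerCorank p ≤ lam ξ := by
  haveI : Module.Finite (IwasawaAlgebra p) D.X := h12.moduleFinite hp hgood hap hκ hγ D
  have hX : Module.IsTorsion (IwasawaAlgebra p) D.X := h12.isTorsion hp hgood hap hκ hγ D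
  exact Summit.BirchSwinnertonDyer.Rank1Residual.X2.le_lam_of_X_pow_dvd (ne_zero_of_charIdeal_eq_span D hξ)
    (D.X_pow_selmerCorank_dvd_of_charIdeal_eq_span hγ hX hξ)

/-- **`corank_{ℤ_p} Sel_{p^∞}(E/ℚ) ≤ λ(L_p^ε)`** (Kato's direction, image-free and `μ`-free): granted `h12` and Thm. 4.1's
rational display (`h41`), for the newform `f`, a cyclotomic frame and a Pollack pair, `corank ≤ λ(ξ^ε) ≤ λ(L_p^ε)`.
[cite: Kobayashi2003, Thm. 1.2 and Thm. 4.1 (p. 8)] [cite: GreenbergVatsal2000, p. 4] -/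
theorem selmerCorank_le_lam_kobayashiL (h12 : Kobayashi2003.thm12_signedSelmerDual_finite_torsion)
    (h41 : Kobayashi2003.thm41_signedCharIdeal_divisibility) (hp : p ≠ 2)
    (hgood : W.HasGoodReductionAtPrime p) (hap : W.frobeniusTrace p = 0) [NeZero (W.conductorNorm ℤ)]
    {f : CuspForm (Gamma0 (W.conductorNorm ℤ)) 2} (hf : IsNewformOf W f) (hκ : κ.IsCyclotomic)
    (hγ : κ.IsTopGenerator γ) (hγ' : IsCyclotomicVariable p γ) {Lplus Lminus : IwasawaAlgebra p}
    (hPP : IsPollackPair f p Lplus Lminus) (D : SignedSelmerDualData W κ γ ε) :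
    W.selmerCorank p ≤ lam (kobayashiL ε Lplus Lminus) := by
  obtain ⟨ξ, hξ⟩ := (charIdeal_isPrincipal_holds p D.X).principal
  have hξ' : D.charIdeal = Ideal.span {ξ} := hξ
  obtain ⟨n, hn⟩ := exists_C_pow_mul_mem_charIdeal h12 h41 hp hgood hap hf hκ hγ hγ'
    (hPP.isSignedPAdicLFunction_kobayashiL ε) D
  rw [hξ', Ideal.mem_span_singleton] at hn
  exact (selmerCorank_le_lam_charGen h12 hp hgood hap hκ hγ D hξ').trans
    (lam_le_lam_of_dvd_C_pow_mul (IsPollackPair.kobayashiL_ne_zero p hPP ε) hn)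

/-- **The corank squeeze for the λ-stub (per sign, image-free, `μ`-free).** Granted `h12`, `h41`; odd good `p`, `a_p = 0`.
If `λ(L_p^ε) ≤ corank_{ℤ_p} Sel_{p^∞}(E/ℚ)` for the Pollack pair at hand («no excess zeros»: every zero of `L_p^ε` in the
open unit disc is accounted for by the Selmer corank at `T = 0`), then the stub's `p`-inverted λ-shape holds at every
dual datum of sign `ε` (λ-door: `λ(L_p^ε) ≤ corank ≤ λ(ξ^ε)`). [cite: Kobayashi2003, Thm. 1.2, Thm. 4.1 (p. 8) and Conjecture (p. 2)]
[cite: GreenbergLNM1716, §3 Lemma 3.1] [cite: GreenbergVatsal2000, p. 4] -/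
theorem lambdaShape_of_lam_le_selmerCorank (h12 : Kobayashi2003.thm12_signedSelmerDual_finite_torsion)
    (h41 : Kobayashi2003.thm41_signedCharIdeal_divisibility) (hp : p ≠ 2)
    (hgood : W.HasGoodReductionAtPrime p) (hap : W.frobeniusTrace p = 0) (hκ : κ.IsCyclotomic)
    (hγ : κ.IsTopGenerator γ) (hγ' : IsCyclotomicVariable p γ) [NeZero (W.conductorNorm ℤ)]
    {f : CuspForm (Gamma0 (W.conductorNorm ℤ)) 2} (hf : IsNewformOf W f) {ϖ : ℚ}
    (hϖ : (ϖ : ℝ) * W.realPeriodRat = plusPeriod f) {Lplus Lminus : IwasawaAlgebra p}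
    (hPP : IsPollackPair f p Lplus Lminus) (hle : lam (kobayashiL ε Lplus Lminus) ≤ W.selmerCorank p)
    (D : SignedSelmerDualData W κ γ ε) :
    ∃ (g h : IwasawaAlgebra p) (m : ℕ), D.charIdeal = Ideal.span {g} ∧
      iwasawaToPowerSeries p (PowerSeries.C ((p : ℤ_[p]) ^ m) * g) =
        PowerSeries.C (ϖ : ℚ_[p]) * iwasawaToPowerSeries p (kobayashiL ε Lplus Lminus * h) := by
  have hϖ0 : ϖ ≠ 0 := by
    rintro rfl
    rw [Rat.cast_zero, zero_mul] at hϖ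
    exact (IsNewform0.plusPeriod_pos_holds hf.1 hf.coeffField_eq_bot).ne' hϖ.symm
  have hKato := exists_C_pow_mul_mem_charIdeal h12 h41 hp hgood hap hf hκ hγ hγ'
    (hPP.isSignedPAdicLFunction_kobayashiL ε) D
  exact (lambdaShape_iff_forall_lam_le D hϖ0 (IsPollackPair.kobayashiL_ne_zero p hPP ε) hKato).mpr
    fun ξ hξ ↦ hle.trans (selmerCorank_le_lam_charGen h12 hp hgood hap hκ hγ D hξ)

end Corank

/-! ## §3. Assembly: the stub BY NAME ⟺ its EXCESS-ZERO RESIDUE off the two preprint loci -/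

section Assembly

/-- **The stub BY NAME from the two preprint binders, Kobayashi Thm. 1.2 / 4.1, and its EXCESS-ZERO RESIDUE.**
Hypotheses BY NAME: `hFW`, `hBSTW` (the tree's two unrefereed binders, image-free), `h12`, `h41` (published; only the
rational display of Thm. 4.1), and `hres` — at every `p = 3`, X7, ¬CM, `a_3 = 0`, ¬Surj pair which is OFF the Fouquet–Wan
locus (no non-split multiplicative `ℓ ≠ 3` with `3 ∤ ord_ℓ Δ_min`) and OFF the BSTW twist locus (not a prime-to-`3N`
ordinary-discriminant quadratic twist of a semistable good-supersingular curve), every cyclotomic frame, the newform,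
every Pollack pair whose `L_3^ε` has EXCESS ZEROS (`corank_{ℤ_3} Sel_{3^∞}(E/ℚ) < λ(L_3^ε)`), every dual datum and
generator: the Eisenstein λ-inequality `λ(L_3^ε) ≤ λ(ξ^ε)`. Proof: per pair and sign, the FW locus or the twist locus
(`…LambdaLowerThreeNsDoor` §4), or the corank squeeze (§2), or `hres` through the λ-door. READING: no period fact, no
`p`-parity, no `μ`-statement enters; the parity stratum of slh-p3 g12 is INSIDE the corank squeeze (`λ = 1` forces an odd,
hence positive, corank by `p`-parity — not needed here as a hypothesis: such signs simply never satisfy `corank < λ`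
once parity is known). CALIBRATION ONLY: `hres` is the stub's open content («the excess zeros of `L_3^ε` divide `ξ^ε`»).
[claim: FouquetWan2021, status: under-review] [claim: BurungaleSkinnerTianWan2024, status: under-review]
[cite: Kobayashi2003, Thm. 1.2, Thm. 4.1 (p. 8), Thm. 7.4 (p. 13), Conjecture (p. 2)] [cite: GreenbergLNM1716, §3 Lemma 3.1] -/
theorem smallImageLambdaLowerAtThree_of_loci_of_excessZeroResidue
    (hFW : FouquetWan2021_thm51_via_kobayashi74_OPEN)
    (hBSTW : BurungaleSkinnerTianWan2024_thm13_twist_OPEN)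
    (h12 : Kobayashi2003.thm12_signedSelmerDual_finite_torsion)
    (h41 : Kobayashi2003.thm41_signedCharIdeal_divisibility)
    (hres : ∀ (W : WeierstrassCurve ℚ) [W.IsElliptic] [W.IsGloballyMinimal] (p : ℕ) [Fact p.Prime],
      p = 3 → ClassX7 W p → ¬ W.HasCM → W.frobeniusTrace p = 0 → ¬ Surj W p →
      (¬ ∃ (ℓ : ℕ) (_ : Fact ℓ.Prime), ℓ ≠ p ∧ W.HasMultiplicativeReductionAtPrime ℓ ∧
          ¬ W.HasSplitMultiplicativeReductionAtPrime ℓ ∧ ¬ p ∣ padicValInt ℓ W.minimalDiscriminantInt) →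
      (¬ ∃ (W₀ : WeierstrassCurve ℚ) (_ : W₀.IsElliptic) (_ : W₀.IsGloballyMinimal)
          (K : Type) (_ : Field K) (_ : NumberField K),
          Semistable W₀ ∧ GoodSS W₀ p ∧ (p = 3 → W₀.frobeniusTrace 3 = 0) ∧ Module.finrank ℚ K = 2 ∧
          IsCoprime (NumberField.discr K) ((W₀.conductorNorm ℤ * p : ℕ) : ℤ) ∧
          (∀ (ℓ : ℕ) [Fact ℓ.Prime], (ℓ : ℤ) ∣ NumberField.discr K → GoodOrd W₀ ℓ) ∧
          ∃ C : VariableChange ℚ, C • W₀.quadraticTwist (NumberField.discr K : ℚ) = W) →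
      ∀ (ε : ℤˣ) (κ : ZpExtension ℚ p) (γ : absoluteGaloisGroup ℚ),
          κ.IsCyclotomic → κ.IsTopGenerator γ → IsCyclotomicVariable p γ →
        ∀ [NeZero (W.conductorNorm ℤ)] (f : CuspForm (Gamma0 (W.conductorNorm ℤ)) 2), IsNewformOf W f →
        ∀ (Lplus Lminus : IwasawaAlgebra p), IsPollackPair f p Lplus Lminus →
          W.selmerCorank p < lam (kobayashiL ε Lplus Lminus) →
        ∀ (D : SignedSelmerDualData W κ γ ε) (ξ : IwasawaAlgebra p), D.charIdeal = Ideal.span {ξ} →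
          lam (kobayashiL ε Lplus Lminus) ≤ lam ξ) :
    Summit.BirchSwinnertonDyer.BirchSwinnertonDyer.Theses.SignedLowerHalves.SmallImageLambdaLowerAtThree := by
  intro W _ _ p _ hp3 hX hCM hap hs ε κ γ hκ hγ hγ' _ f hf ϖ hϖ Lplus Lminus hPP D
  have hp : p ≠ 2 := by rw [hp3]; decide
  by_cases hloc : ∃ (ℓ : ℕ) (_ : Fact ℓ.Prime), ℓ ≠ p ∧ W.HasMultiplicativeReductionAtPrime ℓ ∧
      ¬ W.HasSplitMultiplicativeReductionAtPrime ℓ ∧ ¬ p ∣ padicValInt ℓ W.minimalDiscriminantInt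
  · exact lambdaShape_of_thm51_OPEN W p hFW hp hX hap hloc ε κ γ hκ hγ hγ' f hf ϖ hϖ Lplus Lminus hPP D
  by_cases htw : ∃ (W₀ : WeierstrassCurve ℚ) (_ : W₀.IsElliptic) (_ : W₀.IsGloballyMinimal)
      (K : Type) (_ : Field K) (_ : NumberField K),
      Semistable W₀ ∧ GoodSS W₀ p ∧ (p = 3 → W₀.frobeniusTrace 3 = 0) ∧ Module.finrank ℚ K = 2 ∧
      IsCoprime (NumberField.discr K) ((W₀.conductorNorm ℤ * p : ℕ) : ℤ) ∧
      (∀ (ℓ : ℕ) [Fact ℓ.Prime], (ℓ : ℤ) ∣ NumberField.discr K → GoodOrd W₀ ℓ) ∧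
      ∃ C : VariableChange ℚ, C • W₀.quadraticTwist (NumberField.discr K : ℚ) = W
  · obtain ⟨W₀, _, _, K, _, _, hsst, hss, h4, hK, hcop, hord, hWd⟩ := htw
    exact lambdaShape_of_BSTW13_twist_OPEN W p hBSTW hp hsst hss h4 K hK hcop hord hWd ε κ γ hκ hγ hγ' f hf ϖ hϖ
      Lplus Lminus hPP D
  by_cases hle : lam (kobayashiL ε Lplus Lminus) ≤ W.selmerCorank p
  · exact lambdaShape_of_lam_le_selmerCorank h12 h41 hp hX.1.1 hap hκ hγ hγ' hf hϖ hPP hle D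
  -- off both loci, with excess zeros: the residue through the λ-door
  have hϖ0 : ϖ ≠ 0 := by
    rintro rfl
    rw [Rat.cast_zero, zero_mul] at hϖ
    exact (IsNewform0.plusPeriod_pos_holds hf.1 hf.coeffField_eq_bot).ne' hϖ.symm
  have hKato := exists_C_pow_mul_mem_charIdeal h12 h41 hp hX.1.1 hap hf hκ hγ hγ'
    (hPP.isSignedPAdicLFunction_kobayashiL ε) D
  exact (lambdaShape_iff_forall_lam_le D hϖ0 (IsPollackPair.kobayashiL_ne_zero p hPP ε) hKato).mpr
    (hres W p hp3 hX hCM hap hs hloc htw ε κ γ hκ hγ hγ' f hf Lplus Lminus hPP (not_le.mp hle) D)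

/-- **The converse (trivial): the stub implies its excess-zero residue** — indeed the λ-inequality everywhere (§1),
granted `h12 h41` and the `p = 3` period comparison `h3` (which only supplies a period ratio to instantiate the stub).
[cite: Kobayashi2003, Thm. 1.2, Thm. 4.1 (p. 8) and Conjecture (p. 2)] [cite: Mazur1978, Cor. 4.1] -/
theorem excessZeroResidue_of_smallImageLambdaLowerAtThree
    (h12 : Kobayashi2003.thm12_signedSelmerDual_finite_torsion)
    (h41 : Kobayashi2003.thm41_signedCharIdeal_divisibility)
    (h3 : realPeriodRat_eq_unit_mul_plusPeriod_three)
    (h : Summit.BirchSwinnertonDyer.BirchSwinnertonDyer.Theses.SignedLowerHalves.SmallImageLambdaLowerAtThree) :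
    ∀ (W : WeierstrassCurve ℚ) [W.IsElliptic] [W.IsGloballyMinimal] (p : ℕ) [Fact p.Prime],
      p = 3 → ClassX7 W p → ¬ W.HasCM → W.frobeniusTrace p = 0 → ¬ Surj W p →
      (¬ ∃ (ℓ : ℕ) (_ : Fact ℓ.Prime), ℓ ≠ p ∧ W.HasMultiplicativeReductionAtPrime ℓ ∧
          ¬ W.HasSplitMultiplicativeReductionAtPrime ℓ ∧ ¬ p ∣ padicValInt ℓ W.minimalDiscriminantInt) →
      (¬ ∃ (W₀ : WeierstrassCurve ℚ) (_ : W₀.IsElliptic) (_ : W₀.IsGloballyMinimal)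
          (K : Type) (_ : Field K) (_ : NumberField K),
          Semistable W₀ ∧ GoodSS W₀ p ∧ (p = 3 → W₀.frobeniusTrace 3 = 0) ∧ Module.finrank ℚ K = 2 ∧
          IsCoprime (NumberField.discr K) ((W₀.conductorNorm ℤ * p : ℕ) : ℤ) ∧
          (∀ (ℓ : ℕ) [Fact ℓ.Prime], (ℓ : ℤ) ∣ NumberField.discr K → GoodOrd W₀ ℓ) ∧
          ∃ C : VariableChange ℚ, C • W₀.quadraticTwist (NumberField.discr K : ℚ) = W) →
      ∀ (ε : ℤˣ) (κ : ZpExtension ℚ p) (γ : absoluteGaloisGroup ℚ),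
          κ.IsCyclotomic → κ.IsTopGenerator γ → IsCyclotomicVariable p γ →
        ∀ [NeZero (W.conductorNorm ℤ)] (f : CuspForm (Gamma0 (W.conductorNorm ℤ)) 2), IsNewformOf W f →
        ∀ (Lplus Lminus : IwasawaAlgebra p), IsPollackPair f p Lplus Lminus →
          W.selmerCorank p < lam (kobayashiL ε Lplus Lminus) →
        ∀ (D : SignedSelmerDualData W κ γ ε) (ξ : IwasawaAlgebra p), D.charIdeal = Ideal.span {ξ} →
          lam (kobayashiL ε Lplus Lminus) ≤ lam ξ :=
  fun W _ _ p _ hp3 hX hCM hap hs _ _ ε κ γ hκ hγ hγ' _ f hf Lplus Lminus hPP _ D ξ hξ ↦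
    (smallImageLambdaLowerAtThree_iff_lamLe' h12 h41 h3).mp h W p hp3 hX hCM hap hs ε κ γ hκ hγ hγ' f hf
      Lplus Lminus hPP D ξ hξ

end Assembly

end Summit.BirchSwinnertonDyer.BirchSwinnertonDyer.Theorems.SmallImageLambdaLowerThreeNs

end
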